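import Summits.QuantumFields.YangMills.Theorems.AllWindowsColdBoxTorusGreenSupplement
import Summits.QuantumFields.YangMills.Theorems.AllWindowsColdBoxBoxHighLineKernelHodgeForm

/-!
# Images are never closer than the source: torus distances in the 16-image formula

Route `AllWindowsColdBox`, LINE-19 S3 / LINE-20 U1 (crux ⟨stmt-QuantumFields-24336⟩, parent ⟨24004⟩; STUB-PLAN-U1 rev 2 §6, gradient block (A) /
J′1).  In the image formula ✓`dirichletGreen_interiorSites_eq_imageSum` (`G_I(x,y) = ½Σ_S (−1)^{|S|} G̃_{4H}(x̄ − ε_S ȳ)`) every image point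
`x̄ − ε_S ȳ` of the torus `(ℤ/4Hℤ)⁴` is at least as far from `0` (centred coordinates) as `x − y`:

* `abs_valMinAbs_cast_sub_ge`, `abs_valMinAbs_cast_add_ge` — for `1 ≤ a, b ≤ 2H − 1`: `|ṽ(a − b)| = |a − b|` and `|ṽ(a + b)| ≥ |a − b|`
  (`ṽ` = `valMinAbs` of the residue mod `4H`);
* **`sum_sq_sub_le_sum_valMinAbs_sq_image`** — `Σ_k (x_k − y_k)² ≤ Σ_k ṽ((x̄ − ε_S ȳ)_k)²` for `x, y ∈ interiorSites H` and every `S`.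

Hence the uniform torus bounds (✓`torusGreen_grad_mul_dist_pow_three_le`, `torusGreen_hessian_mul_dist_pow_four_le`) transfer to `G_I` with
`dist ≥ |x − y|`, up to the wall.  Everything proved; no definitions; standard axioms.  HONEST LABEL: glue toward the kernel stubs of two
critic-stamped DRAFT lines; no stub, crux, rung or summit is proved; the Yang–Mills mass gap is NOT proved by this file.
-/

set_option autoImplicit false

namespace Summit.QuantumFields.YangMills.Theorems.AllWindowsColdBoxBoxHighLine.BoxImage

open Finset
open Literature.Probability.LatticeModels

variable {H : ℕ} [NeZero H]

/-- The centred representative `v` of the residue of `m` mod `4H` satisfies `4H ∣ v − m` and `2|v| ≤ 4H`. -/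
theorem valMinAbs_cast_spec (m : ℤ) :
    (4 * (H : ℤ)) ∣ (((m : ZMod (4 * H)).valMinAbs : ℤ) - m) ∧ 2 * |((m : ZMod (4 * H)).valMinAbs : ℤ)| ≤ 4 * (H : ℤ) := by
  constructor
  · have h : ((((m : ZMod (4 * H)).valMinAbs - m : ℤ) : ZMod (4 * H))) = 0 := by
      push_cast
      simp
    have := (ZMod.intCast_zmod_eq_zero_iff_dvd _ (4 * H)).1 h
    push_cast at this
    exact this
  · have := two_mul_abs_valMinAbs_le ((m : ZMod (4 * H)))
    push_cast at this
    exact this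

/-- **Direct coordinate**: for `1 ≤ a, b ≤ 2H − 1`, the centred residue of `a − b` mod `4H` is `a − b` itself. -/
theorem valMinAbs_cast_sub_eq {a b : ℤ} (ha : 1 ≤ a ∧ a + 1 ≤ 2 * (H : ℤ)) (hb : 1 ≤ b ∧ b + 1 ≤ 2 * (H : ℤ)) :
    ((((a - b : ℤ) : ZMod (4 * H))).valMinAbs : ℤ) = a - b := by
  obtain ⟨hdvd, habs⟩ := valMinAbs_cast_spec (H := H) (a - b)
  have h2 := abs_le.1 (show |(((a - b : ℤ) : ZMod (4 * H)).valMinAbs : ℤ)| ≤ 2 * (H : ℤ) by linarith)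
  have hlt : |(((a - b : ℤ) : ZMod (4 * H)).valMinAbs : ℤ) - (a - b)| < 4 * (H : ℤ) := by
    rw [abs_lt]; constructor <;> omega
  have := Int.eq_zero_of_abs_lt_dvd hdvd hlt
  omega

/-- **Reflected coordinate**: for `1 ≤ a, b ≤ 2H − 1`, the centred residue `v` of `a + b` mod `4H` has `|v| ≥ |a − b|`
(`v = a + b` or `v = a + b − 4H`). -/
theorem abs_sub_le_abs_valMinAbs_cast_add {a b : ℤ} (ha : 1 ≤ a ∧ a + 1 ≤ 2 * (H : ℤ)) (hb : 1 ≤ b ∧ b + 1 ≤ 2 * (H : ℤ)) :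
    |a - b| ≤ |((((a + b : ℤ) : ZMod (4 * H))).valMinAbs : ℤ)| := by
  obtain ⟨⟨j, hj⟩, habs⟩ := valMinAbs_cast_spec (H := H) (a + b)
  set v : ℤ := (((a + b : ℤ) : ZMod (4 * H))).valMinAbs with hv
  have hH : (1 : ℤ) ≤ H := by have := ha.2; omega
  have h2 := abs_le.1 (show |v| ≤ 2 * (H : ℤ) by linarith)
  -- `v − (a+b) = 4H·j` with `−6H + 2 ≤ 4H·j ≤ 2H − 2`, so `j ∈ {−1, 0}`
  have hj_cases : j = -1 ∨ j = 0 := by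
    rcases le_or_gt j (-2) with h | h
    · have : 4 * (H : ℤ) * j ≤ 4 * (H : ℤ) * (-2) := mul_le_mul_of_nonneg_left h (by positivity)
      omega
    · rcases le_or_gt 1 j with h' | h'
      · have : 4 * (H : ℤ) * 1 ≤ 4 * (H : ℤ) * j := mul_le_mul_of_nonneg_left h' (by positivity)
        omega
      · omega
  rcases hj_cases with rfl | rfl
  · have hv' : v = a + b - 4 * (H : ℤ) := by linarith
    rw [hv', abs_of_neg (show a + b - 4 * (H : ℤ) < 0 by omega), abs_le]
    constructor <;> omega
  · have hv' : v = a + b := by linarith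
    rw [hv', abs_of_nonneg (show (0 : ℤ) ≤ a + b by omega), abs_le]
    constructor <;> omega

/-- **Images are never closer than the source**: for `x, y ∈ interiorSites H` and every sign pattern `S`,
`Σ_k (x_k − y_k)² ≤ Σ_k ṽ((x̄ − ε_S ȳ)_k)²`. -/
theorem sum_sq_sub_le_sum_valMinAbs_sq_image {x y : Site 4} (hx : x ∈ interiorSites H) (hy : y ∈ interiorSites H)
    (S : Finset (Fin 4)) :
    ∑ k : Fin 4, (((x k - y k : ℤ)) : ℝ) ^ 2 ≤
      ∑ k : Fin 4, (((((fun k => ((x k : ℤ) : ZMod (4 * H))) -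
        (fun k => if k ∈ S then -((y k : ℤ) : ZMod (4 * H)) else ((y k : ℤ) : ZMod (4 * H))) : TorusSite 4 (4 * H)) k).valMinAbs : ℤ) : ℝ) ^ 2 := by
  have hbx := (interiorSites_iff H x).1 hx
  have hby := (interiorSites_iff H y).1 hy
  refine Finset.sum_le_sum fun k _ => ?_
  have hk : |x k - y k| ≤ abs ((((fun k => ((x k : ℤ) : ZMod (4 * H))) -
        (fun k => if k ∈ S then -((y k : ℤ) : ZMod (4 * H)) else ((y k : ℤ) : ZMod (4 * H))) : TorusSite 4 (4 * H)) k).valMinAbs) := by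
    rw [Pi.sub_apply]
    by_cases hkS : k ∈ S
    · rw [if_pos hkS, sub_neg_eq_add, ← Int.cast_add]
      exact abs_sub_le_abs_valMinAbs_cast_add (hbx k) (hby k)
    · rw [if_neg hkS, ← Int.cast_sub, valMinAbs_cast_sub_eq (hbx k) (hby k)]
  generalize (((fun k => ((x k : ℤ) : ZMod (4 * H))) -
        (fun k => if k ∈ S then -((y k : ℤ) : ZMod (4 * H)) else ((y k : ℤ) : ZMod (4 * H))) : TorusSite 4 (4 * H)) k).valMinAbs = v at hk ⊢
  have hk' : |((x k - y k : ℤ) : ℝ)| ≤ |((v : ℤ) : ℝ)| := by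
    rw [← Int.cast_abs, ← Int.cast_abs]; exact_mod_cast hk
  calc (((x k - y k : ℤ)) : ℝ) ^ 2 = |((x k - y k : ℤ) : ℝ)| ^ 2 := (sq_abs _).symm
    _ ≤ |((v : ℤ) : ℝ)| ^ 2 := pow_le_pow_left₀ (abs_nonneg _) hk' 2
    _ = ((v : ℤ) : ℝ) ^ 2 := sq_abs _

end Summit.QuantumFields.YangMills.Theorems.AllWindowsColdBoxBoxHighLine.BoxImage
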